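import Summits.Ventures.CertifiedManyBodySolver.Upper.IntervalReaderQuadAutomaton
import Summits.Ventures.CertifiedManyBodySolver.Upper.IntervalReaderEnclosure

/-!
# Ventures/CertifiedManyBodySolver — Upper/IntervalReaderQuadKernel.lean: the `l3core-sgf` automaton represents its Hamiltonian
(part 20 of the Theorem-H1′ package; parts 1–19: `IntervalReaderSchur` … `IntervalReaderQuadAutomaton`)

HONEST FRAMING: first certified bounds; not a superconductivity verdict; every number certified or labelled
float.  Pure algebra (part 13's path sums + the tree's Jordan–Wigner dictionary of parts 9 / 11); no number is
certified, no row moves; a sourced-Hamiltonian upper is a variational energy CEILING, never a sign of order.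

For part 19's `quadAutomaton τ ν V` (ird-3's `sgf_model` automaton at site level: hopping channels between ANY two
modes on different sites with weights `τ x s y s′`, density channels with weights `ν x s y s′`, on-site words `V k`):

* `productOp_spliceFamily_apply_mid`, `spliceFamily_assoc` — bookkeeping: a product operator's entry is linear in
  the matrix spliced at one site; nested splices re-associate;
* `quad_excursion_dag` / `quad_excursion_ann` — the hopping excursion opened at `k`, closed at `k′ > k`, IS
  `Σ_{s′} τ k s k′ s′ · ⨂ hopFamily k k′ s s′` resp. `Σ_{s′} τ k s k′ s′ · ⨂ hopFamily k′ k s′ s` (part 9's words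
  `= toSpin (c†_{(k,s)} c_{(k′,s′)})` resp. `toSpin (c†_{(k′,s′)} c_{(k,s)})`, for ALL spin pairs);
* `quad_excursion_nn` — the density excursion IS `ν k s k′ s′ · (n_s)_k (n_{s′})_{k′}` (`= toSpin (n_{(k,s)} n_{(k′,s′)})`);
* `automatonKernel_quad_start_fin` — **THE IDENTITY**: `K(START, FINAL) = Σ_k onSite k (V k)`
  `+ Σ_{k<k′} Σ_{s,s′} ( τ k s k′ s′ • (⨂ hopFamily k k′ s s′ + ⨂ hopFamily k′ k s′ s) + ν k s k′ s′ • (n_s)_k (n_{s′})_{k′} )`.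
  With parts 9 / 11 (`toSpin_creation_mul_annihilation_eq_productOp(′)`, `toSpin_numberOp`) every term is the
  `toSpin` of the corresponding fermion word, so this is `toSpin` of the `sgf_model` Hamiltonian
  `Σ_{p<q} τ (c†_p c_q + c†_q c_p) + Σ ε n + Σ V n n + C` with its intra-site part read through `V k`; with part 12's
  `reader_encloses_matrix_element` the `l3core-sgf` multi-state `H`-sweep is end to end like E1's (part 15), and with
  part 11's relabelling the W5 / FORMAT-mpsgf1 sentence shape follows as in part 18 (not restated here);
* `quadWordSum`, `reader_encloses_quadWordSum_element` — that end-to-end statement written out (part 12 with `hW`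
  discharged).
-/

noncomputable section

open Matrix Finset WithLp
open scoped BigOperators ComplexOrder Matrix.Norms.L2Operator

namespace Summit.Ventures.CertifiedManyBodySolver.Upper.IntervalReader

open Literature.MathematicalPhysics.QuantumLattice
open Literature.MathematicalPhysics.QuantumLattice.JordanWigner

variable {q : ℕ}

/-! ## §II  Splice bookkeeping -/

/-- A product operator's entry factors through the matrix spliced at `k`: `mid (ξ k) (η k)` times a number that does
not depend on `mid`. -/
theorem productOp_spliceFamily_apply_mid {L : ℕ} (pre post : Fin L → Matrix (Fin q) (Fin q) ℂ) (k : Fin L)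
    (mid : Matrix (Fin q) (Fin q) ℂ) (ξ η : TensorIndex (Fin L) q) :
    productOp (spliceFamily pre k mid post) ξ η =
      mid (ξ k) (η k) * ∏ j ∈ Finset.univ.erase k, (if j < k then pre j else post j) (ξ j) (η j) := by
  rw [productOp_apply, ← Finset.mul_prod_erase Finset.univ _ (Finset.mem_univ k)]
  congr 1
  · simp [spliceFamily]
  · refine Finset.prod_congr rfl fun j hj => ?_
    have hjk : j ≠ k := Finset.ne_of_mem_erase hj
    simp [spliceFamily, hjk]

/-- Linearity of a product operator's entry in the spliced matrix: sums. -/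
theorem productOp_spliceFamily_mid_sum {L : ℕ} {ι : Type*} (S : Finset ι) (pre post : Fin L → Matrix (Fin q) (Fin q) ℂ)
    (k : Fin L) (m : ι → Matrix (Fin q) (Fin q) ℂ) (ξ η : TensorIndex (Fin L) q) :
    productOp (spliceFamily pre k (∑ i ∈ S, m i) post) ξ η = ∑ i ∈ S, productOp (spliceFamily pre k (m i) post) ξ η := by
  simp only [productOp_spliceFamily_apply_mid, Matrix.sum_apply, Finset.sum_mul]

/-- Linearity of a product operator's entry in the spliced matrix: scalars. -/
theorem productOp_spliceFamily_mid_smul {L : ℕ} (pre post : Fin L → Matrix (Fin q) (Fin q) ℂ) (k : Fin L)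
    (c : ℂ) (m : Matrix (Fin q) (Fin q) ℂ) (ξ η : TensorIndex (Fin L) q) :
    productOp (spliceFamily pre k (c • m) post) ξ η = c * productOp (spliceFamily pre k m post) ξ η := by
  simp only [productOp_spliceFamily_apply_mid, Matrix.smul_apply, smul_eq_mul, mul_assoc]

/-- Nested splices re-associate (`k < k′`): splicing at `k′` inside the tail of a splice at `k` is splicing at `k′`
a family whose head is the splice at `k`. -/
theorem spliceFamily_assoc {L : ℕ} {M : Type*} {k k' : Fin L} (hkk' : k < k') (pre : Fin L → M) (mid : M)
    (pre₂ : Fin L → M) (mid₂ : M) (post₂ : Fin L → M) :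
    spliceFamily pre k mid (spliceFamily pre₂ k' mid₂ post₂) =
      spliceFamily (spliceFamily pre k mid pre₂) k' mid₂ post₂ := by
  funext j
  simp only [spliceFamily]
  rcases lt_trichotomy j k with hjk | rfl | hkj
  · simp [hjk, hjk.trans hkk']
  · simp [hkk']
  · have h1 : ¬ j < k := not_lt.mpr hkj.le
    have h2 : j ≠ k := ne_of_gt hkj
    simp [h1, h2]

/-! ## §JJ  The excursions of the `l3core-sgf` automaton -/

section Quad

variable {N : ℕ} (τ ν : Fin N → Fin 2 → Fin N → Fin 2 → ℂ) (V : Fin N → Matrix (Fin 4) (Fin 4) ℂ)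

/-- **The `dag` excursion is a sum of hopping words over the partner mode.**  Opened at `k` (spin `s`), closed at
`k′ > k`: `Σ_{s′} τ k s k′ s′ · ⨂ hopFamily k k′ s s′`. -/
theorem quad_excursion_dag {k k' : Fin N} (hkk' : k < k') (s : Fin 2) (ξ η : TensorIndex (Fin N) 4) :
    productOp (spliceFamily (fun j => quadAutomaton τ ν V j QState.start QState.start) k
        (quadAutomaton τ ν V k QState.start (QState.qdag k s))
        (spliceFamily (fun j => quadAutomaton τ ν V j (QState.qdag k s) (QState.qdag k s)) k'
          (quadAutomaton τ ν V k' (QState.qdag k s) QState.fin)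
          (fun j => quadAutomaton τ ν V j QState.fin QState.fin))) ξ η =
      ∑ s', τ k s k' s' * productOp (hopFamily k k' s s') ξ η := by
  by_cases hτ : ∀ s', τ k s k' s' = 0
  · -- no partner at `k′`: the closing factor vanishes
    have hclose : quadAutomaton τ ν V k' (QState.qdag k s) QState.fin = 0 := by
      rw [quadAutomaton_qdag_fin, if_pos hkk']
      exact Finset.sum_eq_zero fun s' _ => by rw [hτ s', zero_smul]
    rw [hclose, spliceFamily_assoc hkk', productOp_spliceFamily_zero_apply]
    exact (Finset.sum_eq_zero fun s' _ => by rw [hτ s', zero_mul]).symm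
  · obtain ⟨s₀, hs₀⟩ := not_forall.mp hτ
    have hlive : ∀ j, j < k' → ∃ y, j < y ∧ ∃ s'', τ k s y s'' ≠ 0 := fun j hj => ⟨k', hj, s₀, hs₀⟩
    have hfam : spliceFamily (fun j => quadAutomaton τ ν V j QState.start QState.start) k
        (quadAutomaton τ ν V k QState.start (QState.qdag k s))
        (spliceFamily (fun j => quadAutomaton τ ν V j (QState.qdag k s) (QState.qdag k s)) k'
          (quadAutomaton τ ν V k' (QState.qdag k s) QState.fin)
          (fun j => quadAutomaton τ ν V j QState.fin QState.fin)) =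
        spliceFamily (spliceFamily (fun _ => 1) k (siteCreation s * siteParity) (fun _ => siteParity)) k'
          (∑ s', τ k s k' s' • siteAnnihilation s') (fun _ => 1) := by
      rw [spliceFamily_assoc hkk']
      funext j
      simp only [spliceFamily, quadAutomaton_start_start, quadAutomaton_fin_fin, quadAutomaton_start_qdag,
        quadAutomaton_qdag_qdag, quadAutomaton_qdag_fin, hkk', if_true]
      rcases lt_trichotomy j k with hjk | rfl | hkj
      · simp [hjk, hjk.trans hkk']
      · simp [-Fin.exists_fin_two, -not_exists, hkk', hlive j hkk']
      · rcases lt_trichotomy j k' with hjk' | rfl | hk'j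
        · have h1 : j ≠ k := ne_of_gt hkj
          simp [-Fin.exists_fin_two, -not_exists, h1, hjk', not_lt.mpr hkj.le, hkj, hlive j hjk']
        · simp
        · have h2 : j ≠ k' := ne_of_gt hk'j
          simp [h2, not_lt.mpr hk'j.le]
    rw [hfam, productOp_spliceFamily_mid_sum]
    refine Finset.sum_congr rfl fun s' _ => ?_
    rw [productOp_spliceFamily_mid_smul, hopFamily_eq_spliceFamily hkk', spliceFamily_assoc hkk']

/-- **The `ann` excursion**: `Σ_{s′} τ k s k′ s′ · ⨂ hopFamily k′ k s′ s`. -/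
theorem quad_excursion_ann {k k' : Fin N} (hkk' : k < k') (s : Fin 2) (ξ η : TensorIndex (Fin N) 4) :
    productOp (spliceFamily (fun j => quadAutomaton τ ν V j QState.start QState.start) k
        (quadAutomaton τ ν V k QState.start (QState.qann k s))
        (spliceFamily (fun j => quadAutomaton τ ν V j (QState.qann k s) (QState.qann k s)) k'
          (quadAutomaton τ ν V k' (QState.qann k s) QState.fin)
          (fun j => quadAutomaton τ ν V j QState.fin QState.fin))) ξ η =
      ∑ s', τ k s k' s' * productOp (hopFamily k' k s' s) ξ η := by
  by_cases hτ : ∀ s', τ k s k' s' = 0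
  · have hclose : quadAutomaton τ ν V k' (QState.qann k s) QState.fin = 0 := by
      rw [quadAutomaton_qann_fin, if_pos hkk']
      exact Finset.sum_eq_zero fun s' _ => by rw [hτ s', zero_smul]
    rw [hclose, spliceFamily_assoc hkk', productOp_spliceFamily_zero_apply]
    exact (Finset.sum_eq_zero fun s' _ => by rw [hτ s', zero_mul]).symm
  · obtain ⟨s₀, hs₀⟩ := not_forall.mp hτ
    have hlive : ∀ j, j < k' → ∃ y, j < y ∧ ∃ s'', τ k s y s'' ≠ 0 := fun j hj => ⟨k', hj, s₀, hs₀⟩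
    have hfam : spliceFamily (fun j => quadAutomaton τ ν V j QState.start QState.start) k
        (quadAutomaton τ ν V k QState.start (QState.qann k s))
        (spliceFamily (fun j => quadAutomaton τ ν V j (QState.qann k s) (QState.qann k s)) k'
          (quadAutomaton τ ν V k' (QState.qann k s) QState.fin)
          (fun j => quadAutomaton τ ν V j QState.fin QState.fin)) =
        spliceFamily (spliceFamily (fun _ => 1) k (siteParity * siteAnnihilation s) (fun _ => siteParity)) k'
          (∑ s', τ k s k' s' • siteCreation s') (fun _ => 1) := by
      rw [spliceFamily_assoc hkk']
      funext j
      simp only [spliceFamily, quadAutomaton_start_start, quadAutomaton_fin_fin, quadAutomaton_start_qann,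
        quadAutomaton_qann_qann, quadAutomaton_qann_fin, hkk', if_true]
      rcases lt_trichotomy j k with hjk | rfl | hkj
      · simp [hjk, hjk.trans hkk']
      · simp [-Fin.exists_fin_two, -not_exists, hkk', hlive j hkk']
      · rcases lt_trichotomy j k' with hjk' | rfl | hk'j
        · have h1 : j ≠ k := ne_of_gt hkj
          simp [-Fin.exists_fin_two, -not_exists, h1, hjk', not_lt.mpr hkj.le, hkj, hlive j hjk']
        · simp
        · have h2 : j ≠ k' := ne_of_gt hk'j
          simp [h2, not_lt.mpr hk'j.le]
    rw [hfam, productOp_spliceFamily_mid_sum]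
    refine Finset.sum_congr rfl fun s' _ => ?_
    rw [productOp_spliceFamily_mid_smul, hopFamily_eq_spliceFamily' hkk', spliceFamily_assoc hkk']

/-- The two-site density word `(n_s)_k (n_{s′})_{k′}` as a splice (`k < k′`). -/
theorem numberPair_eq_spliceFamily {k k' : Fin N} (hkk' : k < k') (s s' : Fin 2) :
    Function.update (Function.update (fun _ => (1 : Matrix (Fin 4) (Fin 4) ℂ)) k' (siteNumber s')) k
        (siteNumber s) =
      spliceFamily (spliceFamily (fun _ => 1) k (siteNumber s) (fun _ => 1)) k' (siteNumber s') (fun _ => 1) := by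
  funext j
  simp only [spliceFamily, Function.update_apply]
  rcases lt_trichotomy j k with hjk | rfl | hkj
  · simp [hjk, hjk.trans hkk', ne_of_lt hjk, ne_of_lt (hjk.trans hkk')]
  · simp [hkk']
  · have h1 : ¬ j < k := not_lt.mpr hkj.le
    have h2 : j ≠ k := ne_of_gt hkj
    by_cases hjk' : j = k'
    · subst hjk'
      simp [h2]
    · simp [h1, h2, hjk']

/-- **The density excursion is the two-site density word.**  Channel `qnn x s y s′` entered at `k`, closed at
`k′ > k`: nonzero only for `(x, y) = (k, k′)`, and then `ν k s k′ s′ · (n_s)_k (n_{s′})_{k′}`. -/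
theorem quad_excursion_nn {k k' : Fin N} (hkk' : k < k') (x : Fin N) (s : Fin 2) (y : Fin N) (s' : Fin 2)
    (ξ η : TensorIndex (Fin N) 4) :
    productOp (spliceFamily (fun j => quadAutomaton τ ν V j QState.start QState.start) k
        (quadAutomaton τ ν V k QState.start (QState.qnn x s y s'))
        (spliceFamily (fun j => quadAutomaton τ ν V j (QState.qnn x s y s') (QState.qnn x s y s')) k'
          (quadAutomaton τ ν V k' (QState.qnn x s y s') QState.fin)
          (fun j => quadAutomaton τ ν V j QState.fin QState.fin))) ξ η =
      if x = k ∧ y = k' then ν k s k' s' * (onSite k (siteNumber s) * onSite k' (siteNumber s') : Op (Fin N) 4) ξ η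
      else 0 := by
  by_cases hx : x = k
  · subst hx
    by_cases hy : y = k'
    · subst hy
      rw [if_pos ⟨rfl, rfl⟩]
      by_cases hν : ν x s y s' = 0
      · have hclose : quadAutomaton τ ν V y (QState.qnn x s y s') QState.fin = 0 := by
          rw [quadAutomaton_qnn_fin, if_pos ⟨hkk', rfl⟩, hν, zero_smul]
        rw [hclose, spliceFamily_assoc hkk', productOp_spliceFamily_zero_apply, hν, zero_mul]
      · have hfam : spliceFamily (fun j => quadAutomaton τ ν V j QState.start QState.start) x
            (quadAutomaton τ ν V x QState.start (QState.qnn x s y s'))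
            (spliceFamily (fun j => quadAutomaton τ ν V j (QState.qnn x s y s') (QState.qnn x s y s')) y
              (quadAutomaton τ ν V y (QState.qnn x s y s') QState.fin)
              (fun j => quadAutomaton τ ν V j QState.fin QState.fin)) =
            spliceFamily (spliceFamily (fun _ => 1) x (siteNumber s) (fun _ => 1)) y (ν x s y s' • siteNumber s')
              (fun _ => 1) := by
          rw [spliceFamily_assoc hkk']
          funext j
          simp only [spliceFamily, quadAutomaton_start_start, quadAutomaton_fin_fin, quadAutomaton_start_qnn,
            quadAutomaton_qnn_qnn, quadAutomaton_qnn_fin, hkk']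
          rcases lt_trichotomy j x with hjk | rfl | hkj
          · simp [hjk, hjk.trans hkk']
          · simp [hkk', hν]
          · rcases lt_trichotomy j y with hjk' | rfl | hk'j
            · have h1 : j ≠ x := ne_of_gt hkj
              simp [h1, hjk', not_lt.mpr hkj.le, hkj, hν]
            · simp
            · have h2 : j ≠ y := ne_of_gt hk'j
              simp [h2, not_lt.mpr hk'j.le]
        rw [hfam, productOp_spliceFamily_mid_smul, onSite_mul_onSite_eq_productOp (ne_of_lt hkk'),
          numberPair_eq_spliceFamily hkk']
    · -- opened towards another site: the closing factor at `k′` vanishes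
      rw [if_neg (fun h => hy h.2)]
      have hclose : quadAutomaton τ ν V k' (QState.qnn x s y s') QState.fin = 0 := by
        rw [quadAutomaton_qnn_fin, if_neg (fun h => hy h.2)]
      rw [hclose, spliceFamily_assoc hkk', productOp_spliceFamily_zero_apply]
  · -- not opened at `k`
    rw [if_neg (fun h => hx h.1)]
    have hopen : quadAutomaton τ ν V k QState.start (QState.qnn x s y s') = 0 := by
      rw [quadAutomaton_start_qnn, if_neg (fun h => hx h.1)]
    rw [hopen, productOp_spliceFamily_zero_apply]

/-! ## §KK  The identity -/

/-- **THE IDENTITY for the `l3core-sgf` automaton.**  The `(START, FINAL)` kernel entry over the `N` sites is the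
model's Hamiltonian in the Jordan–Wigner product basis: on-site words, plus for every pair of sites `k < k′` and spins
`s, s′` the two hopping words weighted `τ k s k′ s′` and the density word weighted `ν k s k′ s′`. -/
theorem automatonKernel_quad_start_fin (ξ η : TensorIndex (Fin N) 4) :
    automatonKernel N (quadAutomaton τ ν V) ξ η QState.start QState.fin =
      (∑ k, onSite k (V k) +
        ∑ k, ∑ k', ∑ s : Fin 2, ∑ s' : Fin 2, if k < k' then
          τ k s k' s' • (productOp (hopFamily k k' s s') + productOp (hopFamily k' k s' s)) +
            ν k s k' s' • (onSite k (siteNumber s) * onSite k' (siteNumber s') : Op (Fin N) 4) else 0) ξ η := by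
  rw [automatonKernel_source_apply N (quadAutomaton τ ν V) QState.start QState.fin QState.start_ne_fin
    (quadAutomaton_fin_of_ne τ ν V) (quadAutomaton_channel_of_ne τ ν V) ξ η]
  simp only [Matrix.add_apply, Matrix.sum_apply]
  congr 1
  · -- direct jumps: the on-site words
    refine Finset.sum_congr rfl fun k _ => ?_
    simp only [quadAutomaton_start_start, quadAutomaton_start_fin, quadAutomaton_fin_fin]
    rw [spliceFamily_const_eq_update, ← onSite_eq_productOp]
  · -- excursions
    refine Finset.sum_congr rfl fun k _ => ?_
    refine Finset.sum_congr rfl fun k' _ => ?_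
    by_cases hkk' : k < k'
    · simp only [hkk', true_and, if_true]
      rw [Fintype.sum_sum_type, Fintype.sum_bool, Fintype.sum_sum_type, Fintype.sum_prod_type, Fintype.sum_bool]
      simp only [Fintype.sum_prod_type]
      simp only [QState.start, QState.fin, ne_eq, Sum.inl.injEq, reduceCtorEq, not_true_eq_false,
        not_false_eq_true, Bool.false_eq_true, Bool.true_eq_false, false_and, and_false, and_self, if_false,
        if_true, zero_add, add_zero]
      -- hopping channels: only those opened at `k` survive
      have hdag : ∀ (x : Fin N) (s : Fin 2), productOp (spliceFamily
          (fun j => quadAutomaton τ ν V j (Sum.inl true) (Sum.inl true)) k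
          (quadAutomaton τ ν V k (Sum.inl true) (Sum.inr (Sum.inl (false, x, s))))
          (spliceFamily (fun j => quadAutomaton τ ν V j (Sum.inr (Sum.inl (false, x, s)))
            (Sum.inr (Sum.inl (false, x, s)))) k'
            (quadAutomaton τ ν V k' (Sum.inr (Sum.inl (false, x, s))) (Sum.inl false))
            (fun j => quadAutomaton τ ν V j (Sum.inl false) (Sum.inl false)))) ξ η =
          if x = k then ∑ s', τ k s k' s' * productOp (hopFamily k k' s s') ξ η else 0 := by
        intro x s
        by_cases hx : x = k
        · rw [if_pos hx, hx]
          exact quad_excursion_dag τ ν V hkk' s ξ η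
        · rw [if_neg hx]
          have h0 : quadAutomaton τ ν V k (Sum.inl true) (Sum.inr (Sum.inl (false, x, s))) = 0 := by
            rw [← QState.start, ← QState.qdag, quadAutomaton_start_qdag, if_neg (fun h => hx h.1)]
          rw [h0, productOp_spliceFamily_zero_apply]
      have hann : ∀ (x : Fin N) (s : Fin 2), productOp (spliceFamily
          (fun j => quadAutomaton τ ν V j (Sum.inl true) (Sum.inl true)) k
          (quadAutomaton τ ν V k (Sum.inl true) (Sum.inr (Sum.inl (true, x, s))))
          (spliceFamily (fun j => quadAutomaton τ ν V j (Sum.inr (Sum.inl (true, x, s)))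
            (Sum.inr (Sum.inl (true, x, s)))) k'
            (quadAutomaton τ ν V k' (Sum.inr (Sum.inl (true, x, s))) (Sum.inl false))
            (fun j => quadAutomaton τ ν V j (Sum.inl false) (Sum.inl false)))) ξ η =
          if x = k then ∑ s', τ k s k' s' * productOp (hopFamily k' k s' s) ξ η else 0 := by
        intro x s
        by_cases hx : x = k
        · rw [if_pos hx, hx]
          exact quad_excursion_ann τ ν V hkk' s ξ η
        · rw [if_neg hx]
          have h0 : quadAutomaton τ ν V k (Sum.inl true) (Sum.inr (Sum.inl (true, x, s))) = 0 := by
            rw [← QState.start, ← QState.qann, quadAutomaton_start_qann, if_neg (fun h => hx h.1)]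
          rw [h0, productOp_spliceFamily_zero_apply]
      have hnn : ∀ (x : Fin N) (s : Fin 2) (y : Fin N) (s' : Fin 2), productOp (spliceFamily
          (fun j => quadAutomaton τ ν V j (Sum.inl true) (Sum.inl true)) k
          (quadAutomaton τ ν V k (Sum.inl true) (Sum.inr (Sum.inr ((x, s), (y, s')))))
          (spliceFamily (fun j => quadAutomaton τ ν V j (Sum.inr (Sum.inr ((x, s), (y, s'))))
            (Sum.inr (Sum.inr ((x, s), (y, s'))))) k'
            (quadAutomaton τ ν V k' (Sum.inr (Sum.inr ((x, s), (y, s')))) (Sum.inl false))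
            (fun j => quadAutomaton τ ν V j (Sum.inl false) (Sum.inl false)))) ξ η =
          if x = k ∧ y = k' then
            ν k s k' s' * (onSite k (siteNumber s) * onSite k' (siteNumber s') : Op (Fin N) 4) ξ η else 0 :=
        fun x s y s' => quad_excursion_nn τ ν V hkk' x s y s' ξ η
      simp only [hdag, hann, hnn]
      -- collapse the sums over the opening site (and the partner site of the density channel)
      rw [Finset.sum_comm (f := fun x s => if x = k then ∑ s', τ k s k' s' * productOp (hopFamily k' k s' s) ξ η else 0),
        Finset.sum_comm (f := fun x s => if x = k then ∑ s', τ k s k' s' * productOp (hopFamily k k' s s') ξ η else 0)]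
      simp only [Finset.sum_ite_eq', Finset.mem_univ, if_true]
      have hnn' : (∑ x : Fin N, ∑ s : Fin 2, ∑ y : Fin N, ∑ s' : Fin 2,
          if x = k ∧ y = k' then
            ν k s k' s' * (onSite k (siteNumber s) * onSite k' (siteNumber s') : Op (Fin N) 4) ξ η else 0) =
          ∑ s : Fin 2, ∑ s' : Fin 2,
            ν k s k' s' * (onSite k (siteNumber s) * onSite k' (siteNumber s') : Op (Fin N) 4) ξ η := by
        rw [Finset.sum_eq_single k]
        · simp only [true_and]
          refine Finset.sum_congr rfl fun s _ => ?_
          rw [Finset.sum_eq_single k']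
          · simp
          · intro y _ hy
            simp [hy]
          · intro h; exact absurd (Finset.mem_univ k') h
        · intro x _ hx
          simp [hx]
        · intro h; exact absurd (Finset.mem_univ k) h
      rw [hnn']
      -- assemble
      simp only [Matrix.add_apply, Matrix.smul_apply, smul_eq_mul, ← Finset.sum_add_distrib, mul_add]
      refine Finset.sum_congr rfl fun s _ => ?_
      refine Finset.sum_congr rfl fun s' _ => ?_
      ring
    · simp [hkk']

/-- The word-sum operator of the `l3core-sgf` model on the enumeration order: on-site words `V k`, cross-site hopping
words weighted `τ`, cross-site density words weighted `ν` (the right-hand side of `automatonKernel_quad_start_fin`). -/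
def quadWordSum : Op (Fin N) 4 :=
  ∑ k, onSite k (V k) +
    ∑ k, ∑ k', ∑ s : Fin 2, ∑ s' : Fin 2, if k < k' then
      τ k s k' s' • (productOp (hopFamily k k' s s') + productOp (hopFamily k' k s' s)) +
        ν k s k' s' • (onSite k (siteNumber s) * onSite k' (siteNumber s') : Op (Fin N) 4) else 0

/-- **End to end for the `l3core-sgf` multi-state `H`-sweep.**  Part 12's `reader_encloses_matrix_element` with its
premise `hW` discharged by `automatonKernel_quad_start_fin`: given only the per-step defect bounds of the computed
environments over `quadAutomaton τ ν V`, the number read out of the last `FINAL` environment is within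
`(Σ‖r i‖)(Σ‖r′ j‖) · rad FINAL` of `star (ψ_l) ⬝ᵥ (quadWordSum τ ν V *ᵥ ψ_{l′})`. -/
theorem reader_encloses_quadWordSum_element {D : ℕ} (A : Fin N → MPSTensor 4 D)
    (κ : Fin N → ℝ) (hκ0 : ∀ k, 0 ≤ κ k)
    (hκ : ∀ k (z : EuclideanSpace ℂ (Fin D)), ∑ s, ‖toLp 2 (A k s *ᵥ ofLp z)‖ ^ 2 ≤ κ k * ‖z‖ ^ 2)
    (M : Fin N → QState N → QState N → ℝ) (hM0 : ∀ k b c, 0 ≤ M k b c)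
    (hMrow : ∀ k b c s, ∑ s', ‖quadAutomaton τ ν V k b c s s'‖ ≤ M k b c)
    (hMcol : ∀ k b c s', ∑ s, ‖quadAutomaton τ ν V k b c s s'‖ ≤ M k b c)
    (l l' r r' : Fin D → ℂ) (Yh : Fin (N + 1) → QState N → Matrix (Fin D) (Fin D) ℂ) (ρ : Fin N → QState N → ℝ)
    (hρ : ∀ (k : Fin N) (c : QState N),
      ‖Yh k.succ c - ∑ b, transferOp (A k) (quadAutomaton τ ν V k b c) (Yh k.castSucc b)‖ ≤ ρ k c)
    (rad : Fin (N + 1) → QState N → ℝ)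
    (hr0 : ∀ b, ‖Yh 0 b -
      (Pi.single QState.start (vecMulVec (star l) l') : QState N → Matrix (Fin D) (Fin D) ℂ) b‖ ≤ rad 0 b)
    (hr : ∀ (k : Fin N) (c : QState N), ∑ b, M k b c * κ k * rad k.castSucc b + ρ k c ≤ rad k.succ c) :
    ‖star r ⬝ᵥ (Yh (Fin.last N) QState.fin *ᵥ r') -
        star (mpsOpenVar N A l r) ⬝ᵥ (quadWordSum τ ν V *ᵥ mpsOpenVar N A l' r')‖ ≤
      (∑ i, ‖r i‖) * (∑ j, ‖r' j‖) * rad (Fin.last N) QState.fin :=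
  reader_encloses_matrix_element N A (quadAutomaton τ ν V) κ hκ0 hκ M hM0 hMrow hMcol QState.start QState.fin
    (quadWordSum τ ν V) (fun ξ η => by rw [quadWordSum, ← automatonKernel_quad_start_fin])
    l l' r r' Yh ρ hρ rad hr0 hr

end Quad

end Summit.Ventures.CertifiedManyBodySolver.Upper.IntervalReader

end
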